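import Literature.Barriers.CriticalPhenomena.PlanarEdwardsModelDiffusivePairKernel
import HarnessLib

/-!
# The pair covariance kernel of the planar simple random walk: the two-increment law and `Var(J)`

Sibling proof file of `…PlanarEdwardsModelDiffusivePairKernel` (objects `prob`, `pairJoint`,
`pairKernel`, `overlapLen`, `pairKernelAt`, `coreSum`). PROVED here:

* `expect_two_increments` — **the two-increment law**: for times `i ≤ j ≤ n`, `k ≤ l ≤ n` the
  pair `(ω(j) - ω(i), ω(l) - ω(k))` of increments of the uniform `n`-step planar walk has the law
  of `(X_A + Y_B, Y_B + W_C)` for independent walks of `A, B, C` steps, `B = overlapLen i j k l`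
  the number of shared steps, `A = (j-i) - B`, `C = (l-k) - B` (six interleavings of the two
  pairs; independent increments `expect_increments`);
* `cov_ite_prob_eq_pairKernelAt` — for all `i, j, k, l ≤ n` and `r ≥ 0`,
  `Cov(𝟙{ω(i) = ω(j)}, p_{2r}(ω(l) - ω(k))) = pairKernelAt r i j k l`;
* `variance_selfIntersections_eq_coreSum` — **`Var(J_n) = ¼ coreSum 0 (n+1)`**, and
  `expect_jbar_half_sq_eq_coreSum` — `E(J̄_n/2)² = coreSum 0 (n+1)/(4n²)`: the left side of the
  second-moment limit (α₁) behind `Edwards2D.Stoll1989_invariance_of_secondMomentLimits` as a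
  four-fold kernel sum.

## References

* G. F. Lawler, *Intersections of Random Walks* (1991), §1.3 (Theorem 1.3.2) and Proposition
  6.4.1 (proof). [Lawler1991]
* A. Stoll, Math. Scand. 64 (1989), 133–160, §3. [Stoll1989]
-/

noncomputable section

open Finset Real
open scoped BigOperators

namespace Literature.Barriers.CriticalPhenomena

namespace Edwards2D

open Literature.Probability.LatticeModels Literature.Probability.Percolation

variable {m n : ℕ}


/-! ### The two-increment law -/

/-- Two independent walks of `a` and `c` steps, seen through the sum of their endpoints, are one
walk of `a + c` steps. [cite: Lawler1991, §1.3 (Theorem 1.3.2)] -/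
theorem expect_expect_endpoint_add (a c : ℕ) (G : Site 2 → ℝ) :
    𝔼 α : StepSeq a, 𝔼 γ : StepSeq c, G (endpoint α + endpoint γ) =
      𝔼 δ : StepSeq (a + c), G (endpoint δ) := by
  rw [expect_append (m := a) (k := c)]
  simp only [endpoint_append]

/-- An expectation over `0`-step walks is evaluation at the empty walk (endpoint `0`). [folklore] -/
theorem expect_stepSeq_zero (G : Site 2 → ℝ) : 𝔼 γ : StepSeq 0, G (endpoint γ) = G 0 := by
  rw [Finset.expect_congr rfl fun γ _ => by rw [endpoint_stepSeq_zero γ],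
    Finset.expect_const univ_nonempty]

/-- **The two-increment law** (with the overlap data as parameters): for times `i ≤ j ≤ n`,
`k ≤ l ≤ n`, the pair of increments `(ω(j) - ω(i), ω(l) - ω(k))` is distributed as
`(X_A + Y_B, Y_B + W_C)` for independent walks of `A, B, C` steps, `B = (j ∧ l - i ∨ k)⁺` the
number of shared steps and `A = (j - i) - B`, `C = (l - k) - B` the private ones (six interleavings;
independent increments `expect_increments`). [cite: Lawler1991, §1.3 (Theorem 1.3.2) and Proposition 6.4.1 (proof)] -/
theorem expect_two_increments_aux {n i j k l A B C : ℕ} (hij : i ≤ j) (hkl : k ≤ l) (hjn : j ≤ n)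
    (hln : l ≤ n) (hB : B = min j l - max i k) (hA : A = j - i - B) (hC : C = l - k - B)
    (F : Site 2 → Site 2 → ℝ) :
    𝔼 ω : StepSeq n, F (pos ω j - pos ω i) (pos ω l - pos ω k) =
      𝔼 α : StepSeq A, 𝔼 β : StepSeq B, 𝔼 γ : StepSeq C,
        F (endpoint α + endpoint β) (endpoint β + endpoint γ) := by
  rcases le_or_gt j k with h1 | h1
  · -- separated: `i ≤ j ≤ k ≤ l`
    have hB0 : B = 0 := by subst hB; omega
    subst hB0
    have hA' : A = j - i := by omega
    have hC' : C = l - k := by omega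
    subst hA' hC'
    rw [expect_increments hij h1 hkl hln (fun x _ z => F x z)]
    refine Finset.expect_congr rfl fun α _ => ?_
    rw [Finset.expect_const univ_nonempty, expect_stepSeq_zero (fun y => 𝔼 γ : StepSeq (l - k),
      F (endpoint α + y) (y + endpoint γ))]
    simp only [add_zero, zero_add]
  rcases le_or_gt l i with h2 | h2
  · -- separated: `k ≤ l ≤ i ≤ j`
    have hB0 : B = 0 := by subst hB; omega
    subst hB0
    have hA' : A = j - i := by omega
    have hC' : C = l - k := by omega
    subst hA' hC'
    rw [expect_increments hkl h2 hij hjn (fun x _ z => F z x)]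
    refine (Finset.expect_congr rfl fun α' _ => Finset.expect_const univ_nonempty _).trans ?_
    rw [Finset.expect_comm]
    refine Finset.expect_congr rfl fun α _ => ?_
    rw [expect_stepSeq_zero (fun y => 𝔼 γ : StepSeq (l - k), F (endpoint α + y) (y + endpoint γ))]
    simp only [add_zero, zero_add]
  -- overlapping: `k < j` and `i < l`
  rcases le_total i k with h3 | h3
  · rcases le_total j l with h4 | h4
    · -- interlaced: `i ≤ k < j ≤ l`
      have hB' : B = j - k := by subst hB; omega
      subst hB'
      have hA' : A = k - i := by omega
      have hC' : C = l - j := by omega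
      subst hA' hC'
      have e1 : ∀ ω : StepSeq n, F (pos ω j - pos ω i) (pos ω l - pos ω k) =
          (fun x y z => F (x + y) (y + z)) (pos ω k - pos ω i) (pos ω j - pos ω k) (pos ω l - pos ω j) :=
        fun ω => by simp only [sub_add_sub_cancel']
      rw [Finset.expect_congr rfl fun ω _ => e1 ω, expect_increments h3 h1.le h4 hln (fun x y z => F (x + y) (y + z))]
    · -- nested, second pair inside: `i ≤ k ≤ l ≤ j`
      have hB' : B = l - k := by subst hB; omega
      subst hB'
      have hA' : A = (k - i) + (j - l) := by omega
      have hC' : C = 0 := by omega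
      subst hA' hC'
      have e1 : ∀ ω : StepSeq n, F (pos ω j - pos ω i) (pos ω l - pos ω k) =
          (fun x y z => F (x + y + z) y) (pos ω k - pos ω i) (pos ω l - pos ω k) (pos ω j - pos ω l) :=
        fun ω => by simp only [sub_add_sub_cancel']
      rw [Finset.expect_congr rfl fun ω _ => e1 ω, expect_increments h3 hkl h4 hjn (fun x y z => F (x + y + z) y)]
      rw [Finset.expect_comm]
      conv_rhs => rw [Finset.expect_comm]
      refine Finset.expect_congr rfl fun β _ => ?_
      simp_rw [endpoint_stepSeq_zero, add_zero, Finset.expect_const univ_nonempty]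
      have e2 : ∀ (x : StepSeq (k - i)) (z : StepSeq (j - l)),
          F (endpoint x + endpoint β + endpoint z) (endpoint β) =
            (fun w => F (w + endpoint β) (endpoint β)) (endpoint x + endpoint z) :=
        fun x z => by simp only; congr 1; abel
      simp_rw [e2]
      exact expect_expect_endpoint_add (k - i) (j - l) (fun w => F (w + endpoint β) (endpoint β))
  · rcases le_total l j with h4 | h4
    · -- interlaced: `k ≤ i < l ≤ j`
      have hB' : B = l - i := by subst hB; omega
      subst hB'
      have hA' : A = j - l := by omega
      have hC' : C = i - k := by omega
      subst hA' hC'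
      have e1 : ∀ ω : StepSeq n, F (pos ω j - pos ω i) (pos ω l - pos ω k) =
          (fun x y z => F (y + z) (x + y)) (pos ω i - pos ω k) (pos ω l - pos ω i) (pos ω j - pos ω l) :=
        fun ω => by simp only [sub_add_sub_cancel']
      rw [Finset.expect_congr rfl fun ω _ => e1 ω, expect_increments h3 h2.le h4 hjn (fun x y z => F (y + z) (x + y))]
      rw [Finset.expect_comm]
      conv_rhs => rw [Finset.expect_comm]
      refine Finset.expect_congr rfl fun β _ => ?_
      rw [Finset.expect_comm]
      refine Finset.expect_congr rfl fun α _ => Finset.expect_congr rfl fun γ _ => ?_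
      rw [add_comm (endpoint β) (endpoint α), add_comm (endpoint γ) (endpoint β)]
    · -- nested, first pair inside: `k ≤ i ≤ j ≤ l`
      have hB' : B = j - i := by subst hB; omega
      subst hB'
      have hA' : A = 0 := by omega
      have hC' : C = (i - k) + (l - j) := by omega
      subst hA' hC'
      have e1 : ∀ ω : StepSeq n, F (pos ω j - pos ω i) (pos ω l - pos ω k) =
          (fun x y z => F y (x + y + z)) (pos ω i - pos ω k) (pos ω j - pos ω i) (pos ω l - pos ω j) :=
        fun ω => by simp only [sub_add_sub_cancel']
      rw [Finset.expect_congr rfl fun ω _ => e1 ω, expect_increments h3 hij h4 hln (fun x y z => F y (x + y + z))]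
      rw [Finset.expect_comm, expect_stepSeq_zero (fun y => 𝔼 β : StepSeq (j - i),
        𝔼 γ : StepSeq ((i - k) + (l - j)), F (y + endpoint β) (endpoint β + endpoint γ))]
      refine Finset.expect_congr rfl fun β _ => ?_
      have e2 : ∀ (x : StepSeq (i - k)) (z : StepSeq (l - j)),
          F (endpoint β) (endpoint x + endpoint β + endpoint z) =
            (fun w => F (0 + endpoint β) (endpoint β + w)) (endpoint x + endpoint z) :=
        fun x z => by simp only [zero_add]; congr 1; abel
      simp_rw [e2]
      exact expect_expect_endpoint_add (i - k) (l - j) (fun w => F (0 + endpoint β) (endpoint β + w))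

/-- For ordered pairs `i ≤ j`, `k ≤ l` the overlap is `(j ∧ l - i ∨ k)⁺`. [folklore] -/
theorem overlapLen_of_le {i j k l : ℕ} (hij : i ≤ j) (hkl : k ≤ l) :
    overlapLen i j k l = min j l - max i k := by
  unfold overlapLen
  rw [max_eq_right hij, min_eq_left hij, max_eq_right hkl, min_eq_left hkl]

/-- **The two-increment law**: for `i ≤ j ≤ n`, `k ≤ l ≤ n`, the pair
`(ω(j) - ω(i), ω(l) - ω(k))` has the law of `(X_A + Y_B, Y_B + W_C)` for independent walks of
`A = (j - i) - B`, `B = overlapLen i j k l`, `C = (l - k) - B` steps.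
[cite: Lawler1991, §1.3 (Theorem 1.3.2) and Proposition 6.4.1 (proof)] -/
theorem expect_two_increments {n i j k l : ℕ} (hij : i ≤ j) (hkl : k ≤ l) (hjn : j ≤ n)
    (hln : l ≤ n) (F : Site 2 → Site 2 → ℝ) :
    𝔼 ω : StepSeq n, F (pos ω j - pos ω i) (pos ω l - pos ω k) =
      𝔼 α : StepSeq (j - i - overlapLen i j k l), 𝔼 β : StepSeq (overlapLen i j k l),
        𝔼 γ : StepSeq (l - k - overlapLen i j k l),
          F (endpoint α + endpoint β) (endpoint β + endpoint γ) :=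
  expect_two_increments_aux hij hkl hjn hln (overlapLen_of_le hij hkl) rfl rfl F

/-- One increment: `ω(l) - ω(k)` (`k ≤ l ≤ n`) has the law of the endpoint of an `(l-k)`-step
walk. [cite: Lawler1991, §1.3 (Theorem 1.3.2)] -/
theorem expect_one_increment {n k l : ℕ} (hkl : k ≤ l) (hln : l ≤ n) (G : Site 2 → ℝ) :
    𝔼 ω : StepSeq n, G (pos ω l - pos ω k) = 𝔼 δ : StepSeq (l - k), G (endpoint δ) := by
  rw [expect_increments hkl le_rfl le_rfl hln (fun x _ _ => G x)]
  simp only [Finset.expect_const univ_nonempty]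

/-! ### The covariance of a vanishing increment and a smoothed increment is the pair kernel -/

/-- `p_{2r}(y) = P[y + S'_{2r} = 0]`. [folklore] -/
theorem prob_eq_expect_add (m : ℕ) (y : Site 2) :
    prob m y = 𝔼 ρ : StepSeq m, (if y + endpoint ρ = 0 then (1 : ℝ) else 0) := by
  rw [← prob_neg, prob_eq]
  exact Finset.expect_congr rfl fun ρ _ => if_congr (by rw [eq_neg_iff_add_eq_zero, add_comm]) rfl rfl

/-- **The covariance identity** (ordered pairs): for `i ≤ j ≤ n`, `k ≤ l ≤ n` and `r ≥ 0`,
`Cov(𝟙{ω(i) = ω(j)}, p_{2r}(ω(l) - ω(k))) = pairKernelAt r i j k l`.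
[cite: Lawler1991, Proposition 6.4.1 (proof)] [cite: Stoll1989, §3] -/
theorem cov_ite_prob_eq_pairKernelAt_of_le {n i j k l : ℕ} (hij : i ≤ j) (hkl : k ≤ l) (hjn : j ≤ n)
    (hln : l ≤ n) (r : ℕ) :
    𝔼 ω : StepSeq n, (if pos ω i = pos ω j then (1 : ℝ) else 0) * prob (2 * r) (pos ω l - pos ω k) -
      (𝔼 ω : StepSeq n, if pos ω i = pos ω j then (1 : ℝ) else 0) *
        𝔼 ω : StepSeq n, prob (2 * r) (pos ω l - pos ω k) = pairKernelAt r i j k l := by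
  set B := overlapLen i j k l with hBdef
  have hBle : B ≤ j - i := by rw [hBdef, overlapLen_of_le hij hkl]; omega
  have hBle' : B ≤ l - k := by rw [hBdef, overlapLen_of_le hij hkl]; omega
  -- the joint term
  have hF : ∀ ω : StepSeq n, (if pos ω i = pos ω j then (1 : ℝ) else 0) * prob (2 * r) (pos ω l - pos ω k) =
      (fun x y => (if x = 0 then (1 : ℝ) else 0) * prob (2 * r) y) (pos ω j - pos ω i) (pos ω l - pos ω k) :=
    fun ω => by simp only [sub_eq_zero]; exact congrArg₂ _ (if_congr eq_comm rfl rfl) rfl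
  have hjoint : 𝔼 ω : StepSeq n, (if pos ω i = pos ω j then (1 : ℝ) else 0) * prob (2 * r) (pos ω l - pos ω k) =
      pairJoint (j - i - B) B (l - k - B + 2 * r) := by
    rw [Finset.expect_congr rfl fun ω _ => hF ω,
      expect_two_increments hij hkl hjn hln (fun x y => (if x = 0 then (1 : ℝ) else 0) * prob (2 * r) y)]
    unfold pairJoint
    refine Finset.expect_congr rfl fun α _ => Finset.expect_congr rfl fun β _ => ?_
    simp_rw [prob_eq_expect_add (2 * r), Finset.mul_expect, add_assoc]
    exact expect_expect_endpoint_add (l - k - B) (2 * r)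
      (fun w => (if endpoint α + endpoint β = 0 then (1 : ℝ) else 0) * (if endpoint β + w = 0 then (1 : ℝ) else 0))
  -- the marginals
  have hm1 : 𝔼 ω : StepSeq n, (if pos ω i = pos ω j then (1 : ℝ) else 0) = prob (j - i - B + B) 0 := by
    rw [expect_ite_pos_eq_eq hij hjn, Nat.sub_add_cancel hBle, prob_eq]
  have hm2 : 𝔼 ω : StepSeq n, prob (2 * r) (pos ω l - pos ω k) = prob (B + (l - k - B + 2 * r)) 0 := by
    rw [expect_one_increment hkl hln, show B + (l - k - B + 2 * r) = (l - k) + 2 * r by omega,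
      prob_add_zero]
    refine Finset.expect_congr rfl fun δ _ => ?_
    rw [prob_eq_expect_add]
  rw [hjoint, hm1, hm2]
  unfold pairKernelAt pairKernel
  rw [max_eq_right hij, min_eq_left hij, max_eq_right hkl, min_eq_left hkl]

/-- **The covariance identity**: for all times `i, j, k, l ≤ n` and `r ≥ 0`,
`Cov(𝟙{ω(i) = ω(j)}, p_{2r}(ω(l) - ω(k))) = pairKernelAt r i j k l`.
[cite: Lawler1991, Proposition 6.4.1 (proof)] [cite: Stoll1989, §3] -/
theorem cov_ite_prob_eq_pairKernelAt {n i j k l : ℕ} (hin : i ≤ n) (hjn : j ≤ n) (hkn : k ≤ n)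
    (hln : l ≤ n) (r : ℕ) :
    𝔼 ω : StepSeq n, (if pos ω i = pos ω j then (1 : ℝ) else 0) * prob (2 * r) (pos ω l - pos ω k) -
      (𝔼 ω : StepSeq n, if pos ω i = pos ω j then (1 : ℝ) else 0) *
        𝔼 ω : StepSeq n, prob (2 * r) (pos ω l - pos ω k) = pairKernelAt r i j k l := by
  -- reduce to ordered pairs by the symmetries
  have key : ∀ {i j k l : ℕ}, i ≤ j → j ≤ n → k ≤ n → l ≤ n →
      𝔼 ω : StepSeq n, (if pos ω i = pos ω j then (1 : ℝ) else 0) * prob (2 * r) (pos ω l - pos ω k) -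
        (𝔼 ω : StepSeq n, if pos ω i = pos ω j then (1 : ℝ) else 0) *
          𝔼 ω : StepSeq n, prob (2 * r) (pos ω l - pos ω k) = pairKernelAt r i j k l := by
    intro i j k l hij hjn hkn hln
    rcases le_total k l with hkl | hlk
    · exact cov_ite_prob_eq_pairKernelAt_of_le hij hkl hjn hln r
    · have h := cov_ite_prob_eq_pairKernelAt_of_le hij hlk hjn hkn r
      rw [pairKernelAt_swap_right] at h
      rw [← h]
      simp_rw [← prob_neg (2 * r) (pos _ l - pos _ k), neg_sub]
  rcases le_total i j with hij | hji
  · exact key hij hjn hkn hln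
  · have h := key hji hin hkn hln
    rw [pairKernelAt_swap_left] at h
    rw [← h]
    simp_rw [eq_comm (a := pos _ i)]

/-! ### `Var(J_n)` as a quarter of the four-fold kernel sum -/

/-- A degenerate second pair contributes nothing: `pairKernelAt r i j k k = 0`. [folklore] -/
theorem pairKernelAt_self_right (r i j k : ℕ) : pairKernelAt r i j k k = 0 := by
  unfold pairKernelAt
  have h : overlapLen i j k k = 0 := by unfold overlapLen; omega
  rw [h, pairKernel_zero_mid]

/-- Half-sum of a symmetric kernel with zero diagonal: `Σ_{s ≤ N} Σ_{t ∈ (s,N]} φ = ½ Σ_{s,t ≤ N} φ`.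
[folklore] -/
theorem sum_Ioc_eq_half_sum_sum {N : ℕ} (φ : ℕ → ℕ → ℝ) (hsymm : ∀ x y, φ x y = φ y x)
    (hdiag : ∀ x, φ x x = 0) :
    ∑ s ∈ range (N + 1), ∑ t ∈ Ioc s N, φ s t =
      (1 / 2) * ∑ s ∈ range (N + 1), ∑ t ∈ range (N + 1), φ s t := by
  have hIoc : ∀ s ∈ range (N + 1), ∑ t ∈ Ioc s N, φ s t =
      ∑ t ∈ range (N + 1), if s < t then φ s t else 0 := by
    intro s _
    rw [← Finset.sum_filter]
    congr 1
    ext t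
    simp only [mem_Ioc, mem_filter, mem_range]
    omega
  rw [Finset.sum_congr rfl hIoc]
  -- the full sum splits into `s < t`, `t < s` (equal by symmetry) and the zero diagonal
  have hsplit : ∀ s ∈ range (N + 1), ∀ t ∈ range (N + 1),
      φ s t = (if s < t then φ s t else 0) + (if t < s then φ s t else 0) := by
    intro s _ t _
    rcases lt_trichotomy s t with h | rfl | h
    · rw [if_pos h, if_neg (lt_asymm h), add_zero]
    · rw [if_neg (lt_irrefl _), add_zero, hdiag]
    · rw [if_neg (lt_asymm h), if_pos h, zero_add]
  have hswap : ∑ s ∈ range (N + 1), ∑ t ∈ range (N + 1), (if t < s then φ s t else 0) =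
      ∑ s ∈ range (N + 1), ∑ t ∈ range (N + 1), (if s < t then φ s t else 0) := by
    rw [Finset.sum_comm]
    exact Finset.sum_congr rfl fun s _ => Finset.sum_congr rfl fun t _ => by rw [hsymm]
  rw [Finset.sum_congr rfl fun s hs => Finset.sum_congr rfl fun t ht => hsplit s hs t ht]
  simp only [Finset.sum_add_distrib]
  rw [hswap]
  ring

/-- **`Var(J_n) = ¼ Σ_{i,j,k,l ≤ n} pairKernelAt 0 i j k l`**: the variance of the
self-intersection count is the four-fold sum of the pair covariances (the sum over ordered pairs
`i < j`, `k < l` is a quarter of the sum over all `(i,j,k,l)`, the kernel being symmetric in each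
pair and zero on degenerate pairs). [cite: Lawler1991, Proposition 6.4.1 (proof)] -/
theorem variance_selfIntersections_eq_coreSum (n : ℕ) :
    𝔼 ω : StepSeq n, ((selfIntersections ω : ℝ) - meanSelfIntersections n) ^ 2 =
      (1 / 4) * coreSum 0 (n + 1) := by
  -- centred indicators
  set X : ℕ → ℕ → StepSeq n → ℝ := fun s t ω =>
    (if pos ω s = pos ω t then (1 : ℝ) else 0) - 𝔼 ω' : StepSeq n, (if pos ω' s = pos ω' t then (1 : ℝ) else 0)
    with hX
  have hJ : ∀ ω : StepSeq n, (selfIntersections ω : ℝ) - meanSelfIntersections n =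
      ∑ s ∈ range (n + 1), ∑ t ∈ Ioc s n, X s t ω := by
    intro ω
    simp only [hX, Finset.sum_sub_distrib]
    rw [selfIntersections_eq_sum]
    congr 1
    unfold meanSelfIntersections
    simp_rw [selfIntersections_eq_sum]
    rw [Finset.expect_sum_comm]
    exact Finset.sum_congr rfl fun s _ => Finset.expect_sum_comm _ _ _
  -- `𝔼[X_p X_{p'}] = pairKernelAt 0`
  have hcov : ∀ s ∈ range (n + 1), ∀ t ∈ Ioc s n, ∀ s' ∈ range (n + 1), ∀ t' ∈ Ioc s' n,
      𝔼 ω : StepSeq n, X s t ω * X s' t' ω = pairKernelAt 0 s t s' t' := by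
    intro s hs t ht s' hs' t' ht'
    rw [mem_range] at hs hs'
    rw [mem_Ioc] at ht ht'
    have h := cov_ite_prob_eq_pairKernelAt (r := 0) (i := s) (j := t) (k := s') (l := t')
      (by omega) ht.2 (by omega) ht'.2
    have hp : ∀ ω : StepSeq n, prob (2 * 0) (pos ω t' - pos ω s') =
        (if pos ω s' = pos ω t' then (1 : ℝ) else 0) := fun ω => by
      rw [mul_zero, prob_zero_left]
      exact if_congr (sub_eq_zero.trans eq_comm) rfl rfl
    simp_rw [hp] at h
    rw [← h]
    have e : ∀ p q P Q : ℝ, (p - P) * (q - Q) = p * q - Q * p - P * q + P * Q := by intros; ring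
    simp only [hX, e, Finset.expect_add_distrib, Finset.expect_sub_distrib, ← Finset.mul_expect,
      Finset.expect_const univ_nonempty]
    ring
  -- expand the square
  simp_rw [hJ, sq, Finset.sum_mul_sum, Finset.expect_sum_comm]
  rw [Finset.sum_congr rfl fun s hs => Finset.sum_congr rfl fun s' hs' =>
    Finset.sum_congr rfl fun t ht => Finset.sum_congr rfl fun t' ht' => hcov s hs t ht s' hs' t' ht']
  rw [Finset.sum_congr rfl fun s _ => Finset.sum_comm]
  -- symmetrise the two pair sums
  unfold coreSum
  have inner : ∀ s t : ℕ, ∑ s' ∈ range (n + 1), ∑ t' ∈ Ioc s' n, pairKernelAt 0 s t s' t' =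
      (1 / 2) * ∑ s' ∈ range (n + 1), ∑ t' ∈ range (n + 1), pairKernelAt 0 s t s' t' :=
    fun s t => sum_Ioc_eq_half_sum_sum (fun s' t' => pairKernelAt 0 s t s' t')
      (fun x y => pairKernelAt_swap_right 0 s t y x) (fun x => pairKernelAt_self_right 0 s t x)
  simp_rw [inner]
  rw [sum_Ioc_eq_half_sum_sum (fun s t => (1 / 2) * ∑ s' ∈ range (n + 1), ∑ t' ∈ range (n + 1),
      pairKernelAt 0 s t s' t')]
  · simp_rw [← Finset.mul_sum]; ring
  · intro x y; simp_rw [pairKernelAt_swap_left 0 y x]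
  · intro x; simp [pairKernelAt_self_left]

/-- **`E (J̄_n/2)² = coreSum 0 (n+1) / (4n²)`** (`J̄_n = (2/n)(J - ⟨J⟩)`; for `n = 0` both sides
vanish). [cite: Lawler1991, Proposition 6.4.1 (proof)] -/
theorem expect_jbar_half_sq_eq_coreSum (n : ℕ) :
    𝔼 ω : StepSeq n, (jbar n ω / 2) ^ 2 = coreSum 0 (n + 1) / (4 * (n : ℝ) ^ 2) := by
  have h : ∀ ω : StepSeq n, (jbar n ω / 2) ^ 2 =
      (1 / (n : ℝ) ^ 2) * ((selfIntersections ω : ℝ) - meanSelfIntersections n) ^ 2 := by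
    intro ω; unfold jbar; ring
  simp_rw [h]
  rw [← Finset.mul_expect, variance_selfIntersections_eq_coreSum]
  rcases Nat.eq_zero_or_pos n with rfl | hn
  · simp
  · have : (n : ℝ) ≠ 0 := by exact_mod_cast hn.ne'
    field_simp


end Edwards2D

end Literature.Barriers.CriticalPhenomena
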